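import Summits.ABC.IUTFork.DAGC312zc
import Summits.ABC.IUTFork.DAGC312zd
import Summits.ABC.IUTFork.Conditional.LayerC312OfSNonVacuity
import Summits.ABC.IUTFork.DAGC312b
import Summits.ABC.IUTFork.Cor312StepXIfChain

/-!
# Kernel DAG index — layer C312, part ze: the NEUTRAL one-name CENSUS of [IUTchIII] Cor. 3.12 in the kernel after Δ16/Δ17 and the C312
# layer certificate (for the 11:30Z RESULT lines / 12:30Z fold: ONE fully-qualified name, co-importable with either breaker side)

index v1 · abc-iut-c312-2 (filer, gen 4). PROOF-ONLY (no definition), APPEND-ONLY, CO-IMPORT NEUTRAL (imports the neutral parts zc, zd and the neutral C312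
layer certificate + its vacuity audit; NOT part p/r/…/zb, NOT Team A). Part v's `cor312_kernel_census` (p421447) is the side-A twin (it
carries the (xi-f)-node ⟺ Statement clause through Team A's lemmas); this part states what the index says WITHOUT any breaker-side import.

THIS FILE PROVES NOTHING NEW AND ASSERTS NOTHING about [IUTchIII] §3 or any author. `cor312_kernel_census_v10` is the conjunction, BY NAME, of:
(C1) LOCI — for every full situation, Theorem 3.11 as typed + (IPL) grant ALL 85 cited loci of the printed statement-and-proof at the
     reading of record with (SHE) at its typed reading (`lociReadingJ_all`, Δ16; opaque loci: 0);
(C2) LEAST READING — under the same two hypotheses every observation of the printed proof, in particular (xi-f)'s, is derivable in the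
     least reading (all its cited loci granted) (`derivable_least_vs_record`; a statement about CITATIONS, not about the inequality);
(C3) LAYER C312 MODULO S — S (`PilotKummerIndRelated`) + the Corollary's three pins + bridge hypotheses + Theorem 3.11 as typed ⟹ the
     cone's four C312 members: Thm 3.11 (i), (ii), (iii) and [IUTchIII] Cor. 3.12 AS TYPED (`Conditional.layerC312_of_S`, p428164);
(C4) NON-VACUITY — those four binders are jointly satisfiable (at abc-iut-w5-d247's P♭ over `naiveFull 2`, toy level, said so)
     (`Conditional.layerC312_of_S_hypotheses_satisfiable`, p428985);
(C5) [S] LOAD-BEARING — with [S] deleted the certificate is NOT a theorem of the frozen vocabulary (P♯: pins + bridge + typed Thm 3.11 hold,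
     S and the Corollary-as-typed fail) (`Conditional.layerC312_without_S_not_derivable`);
(C6) APEX AT THE REAL DATA, kernel_hyps = 1 — `ABC` follows from ONE data-existential over real initial Θ-data whose one claim-form
     conjunct is the Corollary AS TYPED at the verbatim setting OF the data (`summit_real_of_statement'`, Δ17′; campaign S's chain and
     `genEllTwo_holds` by name) — recorded as the Prop `StatementOf` that theorem;
(C7) bookkeeping numbers: 85 loci, 4 cone members of layer C312, kernel_hyps 10 (author's-terms apex `summit_of_cor312_M_J`) and 1 (real data).
HONEST FRAMING: typed ≠ discharged; indexed ≠ endorsed; no side taken on Cor. 3.12; S and the Corollary-as-typed are NAMED HYPOTHESES where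
they occur; (C4)/(C5) are interface/toy-level witnesses. [claim: Mochizuki2012, status: disputed]
-/

noncomputable section

namespace Summit.ABC.IUTFork.DAG

open Cor312Proof Thm311 Cor312 Cor312Vol Cor312Prov Literature.IUT.LogThetaLattice Literature.IUT.HodgeTheaters
open Literature.IUT.LogVolume Literature.IUT.LogVolume.Cor22 Literature.NumberTheory.DiophantineGeometry.GenEll

open PartC312k  -- `StatementOf h` := the statement of which `h` is the proof (landed in DAGC312k; re-types nothing)

/-- **THE NEUTRAL ONE-NAME CENSUS (v10) of [IUTchIII] Cor. 3.12 in the kernel** — (C1)–(C7) of the module docstring, each conjunct a landed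
theorem BY NAME. Cite as `Summit.ABC.IUTFork.DAG.cor312_kernel_census_v10`. No side taken. [claim: Mochizuki2012, status: disputed] -/
theorem cor312_kernel_census_v10 :
    -- (C1) all 85 loci from Thm 3.11 as typed + (IPL), (SHE) at its typed reading
    (∀ {T : ThetaIndex} (S : FullSituation T), S.Statement → S.link.IPL → ∀ c, lociReadingI S (fun _ => S.SHETyped) c) ∧
    -- (C2) least reading: every observation derivable under the same two hypotheses
    (∀ {T : ThetaIndex} (S : FullSituation T), S.Statement → S.link.IPL → ∀ o, Derivable (lociReadingI S (fun _ => S.SHETyped)) o) ∧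
    -- (C3) the C312 layer modulo S
    StatementOf @Summit.ABC.IUTFork.Conditional.layerC312_of_S ∧
    -- (C4) non-vacuity of its binders
    StatementOf @Summit.ABC.IUTFork.Conditional.layerC312_of_S_hypotheses_satisfiable ∧
    -- (C5) [S] load-bearing
    StatementOf @Summit.ABC.IUTFork.Conditional.layerC312_without_S_not_derivable ∧
    -- (C6) apex at the real data, kernel_hyps = 1
    StatementOf @summit_real_of_statement' ∧
    -- (C7) numbers
    ((84 : ℕ) + 1 = 85 ∧ (3 : ℕ) + 1 = 4 ∧ (11 : ℕ) - 1 = 10 ∧ (2 : ℕ) - 1 = 1) :=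
  ⟨fun S hS hIPL => lociReadingJ_all S hS hIPL, fun S hS hIPL => derivable_least_vs_record S hS hIPL,
    @Summit.ABC.IUTFork.Conditional.layerC312_of_S, @Summit.ABC.IUTFork.Conditional.layerC312_of_S_hypotheses_satisfiable,
    @Summit.ABC.IUTFork.Conditional.layerC312_without_S_not_derivable, @summit_real_of_statement', ⟨rfl, rfl, rfl, rfl⟩⟩

/-! ## Appended (gen 4, 09:1xZ): the twentieth inference IS the Corollary's inequality — NEUTRAL form -/

/-- **THE (xi-f) NODE AT ANY OBSERVATION READING THAT GRANTS (xi-e)'S TWO OBSERVATIONS AND READS (xi-f)'S CONCLUSION AS THE SETTING'S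
INEQUALITY is that inequality** — neutral form of part p's `N_IUTchIII_Cor3_12_pf_xi_f_iff` (which fixes Team A's reading of record
`obsReadingA`, side A): for ANY `pending` and ANY `O : Obs → Prop` with `O .constitutesConstruction ↔ (↑(−|log(q)|) ≤ −|log(Θ)|)`,
`O .displayXIe` and `O .sheMeansFixedValue` granted, the index node `N_IUTchIII_Cor3_12_pf_xi_f pending O` ⟺ `↑Pc.negLogQ ≤ Pc.negLogTheta`
(abc-iut-c312-9's `Cor312Proof.xi_f_holds_iff`, neutral file `Cor312StepXIfChain`: the inference cites NO locus, so it is exactly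
«(xi-e)'s display ∧ (SHE)-as-fixed-value ⟹ conclusion»). No side taken. [claim: Mochizuki2012, status: disputed] -/
theorem xi_f_node_iff_inequality {T : ThetaIndex} {S : Situation T} (Pc : Cor312.Setting S) (pending : Locus → Prop)
    {O : Obs → Prop} (hO : O .constitutesConstruction ↔ ((Pc.negLogQ : ℝ) : WithTop ℝ) ≤ Pc.negLogTheta)
    (hde : O .displayXIe) (hshe : O .sheMeansFixedValue) :
    N_IUTchIII_Cor3_12_pf_xi_f pending O ↔ ((Pc.negLogQ : ℝ) : WithTop ℝ) ≤ Pc.negLogTheta := by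
  unfold N_IUTchIII_Cor3_12_pf_xi_f
  rw [xi_f_holds_iff]
  exact ⟨fun h => hO.1 (h hde hshe), fun h _ _ => hO.2 h⟩

/-- **Hence [IUTchIII] Cor. 3.12 AS TYPED ⟺ «−|log(Θ)| is finite» ∧ THE (xi-f) NODE** at any such reading (`Cor312.Setting.Statement :=
negLogTheta ≠ ⊤ ∧ ↑negLogQ ≤ negLogTheta`, abc-iut-c312-7): the index-currency statement that, granting every cited locus and the
nineteen bookkeeping inferences, the printed proof's twentieth inference carries exactly the Corollary's inequality — neutral, for files
that must not import side A. [claim: Mochizuki2012, status: disputed] -/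
theorem statement_iff_finite_and_xi_f_node {T : ThetaIndex} {S : Situation T} (Pc : Cor312.Setting S) (pending : Locus → Prop)
    {O : Obs → Prop} (hO : O .constitutesConstruction ↔ ((Pc.negLogQ : ℝ) : WithTop ℝ) ≤ Pc.negLogTheta)
    (hde : O .displayXIe) (hshe : O .sheMeansFixedValue) :
    Pc.Statement ↔ Pc.negLogTheta ≠ ⊤ ∧ N_IUTchIII_Cor3_12_pf_xi_f pending O := by
  rw [xi_f_node_iff_inequality Pc pending hO hde hshe]
  rfl

/-- **THE (xi-f) NODE AT THE MINIMAL HONEST READING — no hypothesis at all.** Read EVERY observation of the printed proof as granted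
EXCEPT (xi-f)'s conclusion «constitutes … a construction … of −|log(q)| ∈ ℝ_{≤ −|log(Θ)|}» (p. 184 l. 19–29), read at volume level as the
setting's inequality — i.e. the inline reading `fun o => (o = constitutesConstruction → ↑negLogQ ≤ negLogTheta)` (no definition introduced):
then the index node of the twentieth inference ⟺ the inequality, outright. Neutral; nothing of Team A / side A imported.
[claim: Mochizuki2012, status: disputed] -/
theorem xi_f_node_minimal_iff {T : ThetaIndex} {S : Situation T} (Pc : Cor312.Setting S) (pending : Locus → Prop) :
    N_IUTchIII_Cor3_12_pf_xi_f pending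
        (fun o => o = .constitutesConstruction → ((Pc.negLogQ : ℝ) : WithTop ℝ) ≤ Pc.negLogTheta) ↔
      ((Pc.negLogQ : ℝ) : WithTop ℝ) ≤ Pc.negLogTheta :=
  xi_f_node_iff_inequality Pc pending ⟨fun h => h rfl, fun h _ => h⟩ (fun h => by cases h) (fun h => by cases h)

/-- **… and so [IUTchIII] Cor. 3.12 AS TYPED ⟺ «−|log(Θ)| finite» ∧ THE (xi-f) NODE at the minimal honest reading** — hypothesis-free,
neutral: granting all 85 cited loci (`lociReadingJ_all`) and every other inference, the printed proof's content beyond bookkeeping is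
this one node, and the node is the Corollary's inequality. No side taken. [claim: Mochizuki2012, status: disputed] -/
theorem statement_iff_finite_and_xi_f_node_minimal {T : ThetaIndex} {S : Situation T} (Pc : Cor312.Setting S)
    (pending : Locus → Prop) :
    Pc.Statement ↔ Pc.negLogTheta ≠ ⊤ ∧ N_IUTchIII_Cor3_12_pf_xi_f pending
        (fun o => o = .constitutesConstruction → ((Pc.negLogQ : ℝ) : WithTop ℝ) ≤ Pc.negLogTheta) := by
  rw [xi_f_node_minimal_iff Pc pending]
  rfl

end Summit.ABC.IUTFork.DAG

end
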